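import Summits.HodgeConjecture.HodgeConjecture.Theorems.F0P6aStubESHEET   -- ★ p853096 VERBATIM TWIN (LAST part; parts `…F0P6aStubESHEETSocket` p853076 → `…F0P6aStubESHEETOrgans` p853084 ride the import) of tree `Lines/F0_P6a_StubESHEET.lean` f85df0dd86ddfeb6 (729 l.; namespace KEPT)
import HarnessLib
import HarnessLib.Audit.LibrarySuggestionsDenyListCruxes

/-! # F0_P6a_StubESHEET — ED. 4 = SHIM (K6 P∕E column, LEAD F0P6-plan «M-142a» (B) ∕ «M-145d»; pen «L7» LA7-plan (g8; cut tables g7), RE-HOME TABLE v1.7; box LAref-P (g5) first ∕ LA-ref1 (g5) second)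

Every declaration of the previous edition but two (tree sha16 f85df0dd86ddfeb6, 729 l., sorry-free; 19 of its 21 declarations, e.g. `StubESHEET`, `OrganTWIST`, `OrganSHEET`, `OrganSHEETComplex`, `OrganSHEETGlobal`, `IsSheetTwistOf`, `sheetAlgHom`, `stub_TWIST`, `stub_SHEET`, `hole_SHEET_global`, `stub_ESHEET_of_line`)
now lives, byte for byte (module docstring → `/- … -/` archaeology comment; closed `[cite:]` letters carry `(print: …)` locators — gate relocation rule) and under the SAME namespace
`Summit.HodgeConjecture.HodgeConjecture.Cruxes.HLiu418.F0P6aStubESHEET`, in ★ `Theorems/F0P6aStubESHEETSocket.lean` (p853076) → ★ `Theorems/F0P6aStubESHEETOrgans.lean` (p853084) → ★ `Theorems/F0P6aStubESHEET.lean` (p853096); this module keeps its name so that its tree importers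
(`F0_P6a_EExports.lean` and any by-name reader under `open …F0P6aStubESHEET`) resolve unchanged through the import above.
It declares nothing.  DEDUP CUT (gate `dedup.landed` at E2c-1, LEAD «M-142g» (A) ∕ «M-142h» (iv); cure cand 687764ce0ffaa413): the two §1b glue lemmas `natCast_eq_one_of_span_eq_top` ∕ `coprime_of_norm_row_of_level_row`
of ED. 3 (:215∕:227) are token-identical restatements of ★ `Theorems.F0P6aStubESHEETGlobalGlue.{natCast_eq_one_of_span_eq_top, coprime_of_norm_row_of_level_row}` and were NOT re-declared under the kept namespace;
their `…Cruxes.HLiu418.F0P6aStubESHEET.*` spellings retire with ED. 3 — `rg` digit over `lean/`: 0 consumers outside this module (the one in-module consumer `IsSheetTwistOf.coprime_norm_level` now cites the ★ GlobalGlue term by full name) ⇒ NO alias here (an alias is owed only to a name with a live reader, cf. `stub_UNIVFAM` in `Lines/F0_P6a_PELWitnessE.lean` ED. 6).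
ORDER NOTE: written on the LEAD՚s K6 shim-wave word together with the other shims of that wave; its `Lines` rev-closure by name (`F0_P6a_EExports`, `F0_P6a_StubGEN`, `F0_P6a_ModuliDatum`, `F0_D9opRoad2`, `F0_AlbCm`) re-makes in the same
request (NO-CROSS-IMPORT: no environment may hold a `Lines/` ORIGINAL of this module together with its ★ twin); an importer smoke that reads «environment already contains …»
before that request is BUILT is this order note, not a defect.  Edition history stays in the line card and in git; future changes are ★-side proposals on the `Theorems/` files.
HC_CM is proved only modulo the 7 printed citations (2 remaining named inputs: hLiu418 = stmt-HodgeConjecture-24832, h413 = stmt-HodgeConjecture-24833) until rung 0 closes; count-neutral (0 `sorry`, 0 socket, 0 declarations). -/
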